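import Summits.AtomisticToContinuum.HydrodynamicLimit.Theorems.InformationPercolationEnginePercolationClosesChaosForecastStatements
import Summits.AtomisticToContinuum.HydrodynamicLimit.Theorems.InformationPercolationEnginePercolationClosesChaosDockingCells
import HarnessLib

/-!
# Forecast transfer S6 of the line `equilibrium-forecast-chain-rule` (crux `InformationPercolationEngine.PercolationClosesChaos`,
stmt-AtomisticToContinuum-15178) — piece A: the ARCHITECTURE of the transfer (`kineticCellChaosLG_of`)

Support file (`--supports stmt-AtomisticToContinuum-15178`) of the registered stub
`stub_forecastTransfer : PredictableProjection → MesoConditionalEquidistribution → LocalCountUI → NoMesoscopicOscillation →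
CoarseLocalMaxwellianity → RevealedDefectStability → KineticCellChaosLG` (worker S6 of lead c3). It FIXES THE DAG of the transfer
in Lean: five typed hypotheses `H1`–`H5`, each an honest statement about the `LG`-means `unitMean` of unit-indexed families and
their `G_N`-forecasts `gForecast` (conditional expectations given `σ(seqHist k q)` under the invariant law `eqLaw`), and the
sorry-free composition `kineticCellChaosLG_of : H1 → H2 → H3 → H4 → H5 → KineticCellChaosLG` (registered headline) — quantifier
bookkeeping (`σ₀ = min`, `c₀ = max`, the bin width `b := b₀(c)` of `H4` chosen AFTER `c` and before `N`, `N₀ = max`) and the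
linear chain
`m(bW_η) ≤ m(X̃) ≤ m(Ĝ X̃) + ε ≤ m(Ĝ bW_{η/2}) + m(Ĝ R) + ε ≤ m(Ĝ bW_{η/2}) + m(R) + 2ε ≤ 27δₘ + T δ₂ + T δ₃ + δ₄ + 2ε = δ`
(`bW_η = badWeight Ψ η T`, `X̃, R` the revealed majorant and remainder of `H4`, `Ĝ = gForecast`, `m = unitMean` under `LG`).
Who discharges what (later waves; every `Hi` is provable bookkeeping from the named inputs, none is a new mechanism):

* `H1 = ForecastSwap` ← `PredictableProjection` (S1, proved) in the sequential filtration of pieces E/F/F′ (`Yseq`,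
  `pastSigma_Yseq_eq_seqHist`, `pastSigma_Yseq_succ_eq_seqHistLE`, `pastSigma_Yseq_le`, `sum_range_mul_card_cellBox`), the entropy
  budget `KL(LG ‖ G_N) ≤ A(N+1)` (`exists_lgTransferConst`), the tower property, and `K_N → ∞` (`tendsto_meanFreePath`): the
  remainder is `T h³ √(2 M A (N+1) / K_N) → 0` at fixed `c`;
* `H2 = BadForecastRare` ← `MesoConditionalEquidistribution` (a) VERBATIM + the event/in-mean transfer of `exists_lgTransferConst`
  (`∫ V dLG ≤ δ' + 27 (log 2 + A)/L`, `h³ · #cellBox h ≤ 27`);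
* `H3 = NonGoodRare` ← `CoarseLocalMaxwellianity` + `LocalCountUI` (ii) + `NoMesoscopicOscillation` (ii) WITH ITS IN-BOX GUARD
  (the lead's re-typing; the guard here is "cell occupied at `kΔ`", which implies `∃ x, cellOf x = q`): an occupied non-good cell is
  non-Maxwellian, or packed, or inhomogeneous with a populated neighbourhood;
* `H4 = RevealedSandwich` ← `RevealedDefectStability` (S8) + the deterministic facts "the owned count is a function of the data
  revealed right after `(k, q)`" and `|unitDefect z' − unitDefect z| ≤ defectOsc z` on revealed atoms: `X̃ :=` the supremum of
  `badWeight Ψ η T` over the good part of the atom, `R := min(ownedCount, T) · 𝟙{η/2 ≤ diam_atom unitDefect}`, nested thresholds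
  `η/2 < η`;
* `H5 = ForecastAlgebra` ← conditional-expectation bookkeeping under `G_N` transported to `LG` (`LG ≪ G_N` from the finite budget,
  `LG ≪ liouville`, a.e.-measurability of the statistics from the docking's piece M, atoms Borel from piece F′).
-/

noncomputable section

open MeasureTheory Set Filter Topology
open scoped ENNReal BigOperators Classical
open Literature.Analysis.FluidPDE Literature.MathematicalPhysics.KineticTheory
open Literature.MathematicalPhysics.KineticTheory.VelocityBlindPlacement

namespace Summit.AtomisticToContinuum.HydrodynamicLimit.Theorems.EquilibriumForecastLine

/-! ## The two functionals of the architecture -/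

/-- The MEAN OF A UNIT AVERAGE under a law `μ` on phase space: `∫ unitAvg (k, q ↦ F k q z) dμ(z)` (Bochner; every family the
architecture feeds it is bounded and box-supported, and a.e.-measurable where it matters). -/
def unitMean (c σ : ℝ) (N : ℕ) (τ : ℝ) (μ : Measure (Phase N)) (F : ℕ → Cell → Phase N → ℝ) : ℝ :=
  ∫ z, unitAvg c σ N τ (fun k q => F k q z) ∂μ

/-- The `G_N`-FORECAST of a unit-indexed family: `(k, q) ↦ E_{G_N}[F k q | σ(seqHist b c σ N Φ k q)]` (Mathlib `condExp` given the
comap σ-algebra of the start-cell sequential history under the invariant law `eqLaw` — the very conditional expectation of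
`MesoConditionalEquidistribution` (a)). -/
def gForecast (b c σ : ℝ) (N : ℕ) (Φ : Flow σ N) (F : ℕ → Cell → Phase N → ℝ) : ℕ → Cell → Phase N → ℝ :=
  fun k q => MeasureTheory.condExp (MeasurableSpace.comap (seqHist b c σ N Φ k q) ⊤) (eqLaw σ N Φ) (F k q)

/-! ## The five hypotheses -/

/-- **H1 `ForecastSwap`** — the predictable-projection bound, specialised and summed: for continuous positive profiles,
`0 < σ ≤ 1/2`, every flow family, horizon, level `T`, scale `c` and `ε > 0` there is `N₀` such that for `N ≥ N₀`, EVERY bin width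
`b > 0` and EVERY unit-indexed family `X` with values in `[0, T]`, vanishing off the box and REVEALED (each `X k q` constant on the
atoms of `seqHistLE b c σ N (Φ N) k q`), the `LG`-mean of the unit average of `X` and that of its `G_N`-forecasts differ by at most
`ε`. Discharged by: `PredictableProjection` with `Ω = Phase N`, `Y = Yseq`, `X_n = K⁻¹h³ · X (unit n)` (pieces E/F/F′), the budget
`KL(LG‖G_N) ≤ A(N+1)` (`exists_lgTransferConst`), the tower property `∫ X dLG = ∫ E_LG[X | 𝓕] dLG`, and
`T h³ √(2 M A (N+1)/K_N) → 0` (`tendsto_meanFreePath`, `h³ M ≤ 27`, `(N+1) h³ = cellCount` constant in `N`). -/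
def ForecastSwap : Prop :=
  ∀ (a₀ θ₀ : T3 → ℝ) (u₀ : T3 → V3), Continuous a₀ → Continuous θ₀ → Continuous u₀ →
    (∀ x, 0 < a₀ x) → (∀ x, 0 < θ₀ x) →
  ∀ σ : ℝ, 0 < σ → σ ≤ 1 / 2 → ∀ Φ : (N : ℕ) → Flow σ N, ∀ τ : ℝ, 0 < τ → ∀ T : ℝ, 0 < T → ∀ c : ℝ, 0 < c →
  ∀ ε : ℝ, 0 < ε → ∃ N₀ : ℕ, ∀ N : ℕ, N₀ ≤ N → ∀ b : ℝ, 0 < b →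
  ∀ X : ℕ → Cell → Phase N → ℝ,
    (∀ k q z, 0 ≤ X k q z ∧ X k q z ≤ T) →
    (∀ k, ∀ q ∉ cellBox (c * meanFreePath σ N), X k q = fun _ => 0) →
    (∀ k q, q ∈ cellBox (c * meanFreePath σ N) → ∀ z z',
      seqHistLE b c σ N (Φ N) k q z = seqHistLE b c σ N (Φ N) k q z' → X k q z = X k q z') →
    |unitMean c σ N τ (localGibbsLaw σ a₀ u₀ θ₀ N (Φ N)) X -
        unitMean c σ N τ (localGibbsLaw σ a₀ u₀ θ₀ N (Φ N)) (gForecast b c σ N (Φ N) X)| ≤ ε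

/-- **H2 `BadForecastRare`** — the `LG`-fraction of GOOD units with a BAD `G_N`-forecast is small: there are a packing threshold
`φs > 0` and `σ₁ > 0` such that for continuous positive profiles, `0 < σ ≤ min(σ₁, 1/2)`, every flow family, horizon, bounded
continuous `Ψ` and `ϑs, η, δ, T, δ₂ > 0` there are `ϑ > 0` and `c₀` with: for `c ≥ c₀`, every `b > 0` and all large `N`, the
`LG`-mean of the unit-fraction of units `(k, q)` that are `GoodUnit ϑs ϑ φs` at `kΔ` with `E_{G_N}[badWeight Ψ η T (k,q) | σ(seqHist k q)]
> δ` is at most `δ₂`. Discharged by: `MesoConditionalEquidistribution` (a) VERBATIM (the integrand below IS its integrand, `gForecast`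
unfolds to its `condExp`) with `δ' = δ₂/2`, `L = 54 (log 2 + A)/δ₂`, and the in-mean transfer of `exists_lgTransferConst`
(`0 ≤ unitAvg 𝟙 ≤ h³ · #cellBox h ≤ 27` once `h ≤ 1`). -/
def BadForecastRare : Prop :=
  ∃ φs : ℝ, 0 < φs ∧ ∃ σ₁ : ℝ, 0 < σ₁ ∧
  ∀ (a₀ θ₀ : T3 → ℝ) (u₀ : T3 → V3), Continuous a₀ → Continuous θ₀ → Continuous u₀ →
    (∀ x, 0 < a₀ x) → (∀ x, 0 < θ₀ x) →
  ∀ σ : ℝ, 0 < σ → σ ≤ σ₁ → σ ≤ 1 / 2 → ∀ Φ : (N : ℕ) → Flow σ N, ∀ τ : ℝ, 0 < τ →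
  ∀ Ψ : V3 × V3 × V3 → ℝ, Continuous Ψ → (∃ C : ℝ, ∀ p, |Ψ p| ≤ C) →
  ∀ ϑs η δ T δ₂ : ℝ, 0 < ϑs → 0 < η → 0 < δ → 0 < T → 0 < δ₂ →
  ∃ ϑ : ℝ, 0 < ϑ ∧ ∃ c₀ : ℝ, 0 < c₀ ∧ ∀ c : ℝ, c₀ ≤ c → ∀ b : ℝ, 0 < b → ∃ N₀ : ℕ, ∀ N : ℕ, N₀ ≤ N →
    unitMean c σ N τ (localGibbsLaw σ a₀ u₀ θ₀ N (Φ N)) (fun k q z =>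
      if GoodUnit ϑs ϑ φs c σ N ((Φ N).flow ((k : ℝ) * stepLen c σ N) z) q ∧
          δ < gForecast b c σ N (Φ N) (badWeight Ψ η T c σ N (Φ N)) k q z
      then 1 else 0) ≤ δ₂

/-- **H3 `NonGoodRare`** — OCCUPIED NON-GOOD units are rare under the evolved law: for every packing threshold `φs > 0` and
continuous positive profiles there is `σ₀ > 0` such that for `0 < σ < σ₀`, every flow family, horizon and `ϑs, ϑ, δ₃ > 0` there is
`c₀` with: for `c ≥ c₀` and all large `N`, the `LG`-mean of the unit-fraction of units `(k, q)` whose cell is OCCUPIED at `kΔ` and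
NOT `GoodUnit ϑs ϑ φs` is at most `δ₃`. Discharged by: `CoarseLocalMaxwellianity` (occupied, non-Maxwellian) + `LocalCountUI` (ii)
(occupied, packed) + `NoMesoscopicOscillation` (ii) with the lead's in-box guard (inhomogeneous with a populated neighbourhood — an
occupied cell `q` has `q = cellOf x` for a sphere position `x` and a populated neighbourhood), since
`¬ GoodUnit = Dense ∨ inhom > ϑ ∨ relEnt > ϑ`; `σ₀` depends on `φs` through `LocalCountUI`. -/
def NonGoodRare : Prop :=
  ∀ φs : ℝ, 0 < φs →
  ∀ (a₀ θ₀ : T3 → ℝ) (u₀ : T3 → V3), Continuous a₀ → Continuous θ₀ → Continuous u₀ →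
    (∀ x, 0 < a₀ x) → (∀ x, 0 < θ₀ x) →
  ∃ σ₀ : ℝ, 0 < σ₀ ∧ ∀ σ : ℝ, 0 < σ → σ < σ₀ → ∀ Φ : (N : ℕ) → Flow σ N, ∀ τ : ℝ, 0 < τ →
  ∀ ϑs ϑ δ₃ : ℝ, 0 < ϑs → 0 < ϑ → 0 < δ₃ →
  ∃ c₀ : ℝ, 0 < c₀ ∧ ∀ c : ℝ, c₀ ≤ c → ∃ N₀ : ℕ, ∀ N : ℕ, N₀ ≤ N →
    unitMean c σ N τ (localGibbsLaw σ a₀ u₀ θ₀ N (Φ N)) (fun k q z =>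
      if (pop c σ N ((Φ N).flow ((k : ℝ) * stepLen c σ N) z) q).Nonempty ∧
          ¬ GoodUnit ϑs ϑ φs c σ N ((Φ N).flow ((k : ℝ) * stepLen c σ N) z) q
      then 1 else 0) ≤ δ₃

/-- **H4 `RevealedSandwich`** — revealed versus exact: for continuous positive profiles there is `σ₀ > 0` such that for
`0 < σ < σ₀`, every flow family, horizon, bounded continuous `Ψ` and `η, δ₄, T > 0` there is `c₀` with: for every `c ≥ c₀` there
is `b₀ > 0` such that for every bin width `0 < b ≤ b₀` and all large `N` there are two unit-indexed families `X̃` (the REVEALED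
MAJORANT of the increment) and `R` (the REVEALED REMAINDER), both with values in `[0, T]`, vanishing off the box and constant on
the atoms of `seqHistLE b c σ N (Φ N) k q`, with, on the good set of the flow,
`badWeight Ψ η T ≤ X̃ ≤ badWeight Ψ (η/2) T + R` unit by unit, and `LG`-mean of the unit average of `R` at most `δ₄`.
Discharged by: `X̃ (k,q) z := sup {badWeight Ψ η T (k,q) z' : z' ∈ good, seqHistLE k q z' = seqHistLE k q z}`,
`R (k,q) := min(ownedCount, T) · 𝟙{η/2 ≤ diam of unitDefect (k,q) over the good part of the atom}` — using the deterministic facts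
that the owned count is a function of the data revealed right after `(k, q)` on the good set (every owned collision involves a
sphere starting in `q`, whose record lists the partner, whose start cell is in the past) and `|unitDefect| ≤ 2 sup|Ψ|`, the nesting
`η < unitDefect z' ⇒ η/2 < unitDefect z ∨ η/2 ≤ diam`, `diam ≤ 2 · defectOsc`, and `RevealedDefectStability` at `(Ψ, η/5, δ₄, T)`
(its quantifier shape `∃ c₀ ∀ c ∃ b₀ ∀ b ≤ b₀ ∃ N₀` is the one below). -/
def RevealedSandwich : Prop :=
  ∀ (a₀ θ₀ : T3 → ℝ) (u₀ : T3 → V3), Continuous a₀ → Continuous θ₀ → Continuous u₀ →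
    (∀ x, 0 < a₀ x) → (∀ x, 0 < θ₀ x) →
  ∃ σ₀ : ℝ, 0 < σ₀ ∧ ∀ σ : ℝ, 0 < σ → σ < σ₀ → ∀ Φ : (N : ℕ) → Flow σ N, ∀ τ : ℝ, 0 < τ →
  ∀ Ψ : V3 × V3 × V3 → ℝ, Continuous Ψ → (∃ C : ℝ, ∀ p, |Ψ p| ≤ C) →
  ∀ η δ₄ T : ℝ, 0 < η → 0 < δ₄ → 0 < T →
  ∃ c₀ : ℝ, 0 < c₀ ∧ ∀ c : ℝ, c₀ ≤ c → ∃ b₀ : ℝ, 0 < b₀ ∧ ∀ b : ℝ, 0 < b → b ≤ b₀ → ∃ N₀ : ℕ, ∀ N : ℕ, N₀ ≤ N →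
  ∃ X R : ℕ → Cell → Phase N → ℝ,
    (∀ k q z, 0 ≤ X k q z ∧ X k q z ≤ T) ∧ (∀ k q z, 0 ≤ R k q z ∧ R k q z ≤ T) ∧
    (∀ k, ∀ q ∉ cellBox (c * meanFreePath σ N), X k q = fun _ => 0) ∧
    (∀ k, ∀ q ∉ cellBox (c * meanFreePath σ N), R k q = fun _ => 0) ∧
    (∀ k q, q ∈ cellBox (c * meanFreePath σ N) → ∀ z z',
      seqHistLE b c σ N (Φ N) k q z = seqHistLE b c σ N (Φ N) k q z' → X k q z = X k q z') ∧
    (∀ k q, q ∈ cellBox (c * meanFreePath σ N) → ∀ z z',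
      seqHistLE b c σ N (Φ N) k q z = seqHistLE b c σ N (Φ N) k q z' → R k q z = R k q z') ∧
    (∀ k q, ∀ z ∈ (Φ N).good, badWeight Ψ η T c σ N (Φ N) k q z ≤ X k q z) ∧
    (∀ k q, ∀ z ∈ (Φ N).good, X k q z ≤ badWeight Ψ (η / 2) T c σ N (Φ N) k q z + R k q z) ∧
    unitMean c σ N τ (localGibbsLaw σ a₀ u₀ θ₀ N (Φ N)) R ≤ δ₄

/-- **H5 `ForecastAlgebra`** — the forecast bookkeeping of one `N` (no limits, no mechanism): for continuous positive profiles,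
`0 < σ < 1/2`, every `N`, flow, horizon, bounded continuous `Ψ`, `η, T, c, b > 0`, with `LG = localGibbsLaw …`, `bW_η = badWeight Ψ η T`:
(i) DOMINATION ON THE GOOD SET PASSES TO MEANS — for a revealed, box-supported, `[0,T]`-valued `X` with `bW_η ≤ X` on `Φ.good`:
`m(bW_η) ≤ m(X)` (`LG(goodᶜ) = 0`, integrability: `bW` a.e.-measurable by the docking's piece M, `X` Borel by piece F′);
(ii) A SANDWICH ON THE GOOD SET PASSES TO MEANS OF FORECASTS — for revealed, box-supported, `[0,T]`-valued `X, R` and `η' > 0` with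
`X ≤ bW_{η'} + R` on `Φ.good`: `m(Ĝ X) ≤ m(Ĝ bW_{η'}) + m(Ĝ R)` (`condExp` monotone and additive `G_N`-a.e., `G_N(goodᶜ) = 0`,
transported to `LG`-a.e. by `LG ≪ G_N` — finite entropy budget — and integrated: forecasts of `[0,T]`-valued integrands are
`[0,T]`-valued a.e.);
(iii) THE PER-UNIT SPLIT — for `η', δ > 0` and any `ϑs, ϑ, φs`:
`m(Ĝ bW_{η'}) ≤ δ · h³ · #cellBox h + T · m(𝟙{Good ∧ δ < Ĝ bW_{η'}}) + T · m(𝟙{occupied ∧ ¬Good})` — pointwise a.e. per unit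
`Ĝ bW ≤ δ + T 𝟙{Good, Ĝ bW > δ} + T 𝟙{occupied, ¬Good}`, because `0 ≤ Ĝ bW ≤ T` a.e. and `Ĝ bW_{(k,q)} = 0` a.e. where cell `q` is
EMPTY at `kΔ` (the event is `σ(seqHist k q)`-measurable up to the good-set cut and `bW_{(k,q)}` vanishes on it: pull-out);
(iv) THE CURRENCY — `∫⁻ ofReal (unitAvg bW_η) dLG = ofReal (m(bW_η))` (`ofReal_integral_eq_lintegral_ofReal`; `unitAvg bW_η` is
nonnegative, bounded by `27 T`-ish and `LG`-a.e.-measurable since `LG ≪ liouville`). -/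
def ForecastAlgebra : Prop :=
  ∀ (a₀ θ₀ : T3 → ℝ) (u₀ : T3 → V3), Continuous a₀ → Continuous θ₀ → Continuous u₀ →
    (∀ x, 0 < a₀ x) → (∀ x, 0 < θ₀ x) →
  ∀ σ : ℝ, 0 < σ → σ < 1 / 2 → ∀ (N : ℕ) (Φ : Flow σ N) (τ : ℝ), 0 < τ →
  ∀ Ψ : V3 × V3 × V3 → ℝ, Continuous Ψ → (∃ C : ℝ, ∀ p, |Ψ p| ≤ C) →
  ∀ η T c b : ℝ, 0 < η → 0 < T → 0 < c → 0 < b →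
  (∀ X : ℕ → Cell → Phase N → ℝ,
    (∀ k q z, 0 ≤ X k q z ∧ X k q z ≤ T) →
    (∀ k, ∀ q ∉ cellBox (c * meanFreePath σ N), X k q = fun _ => 0) →
    (∀ k q, q ∈ cellBox (c * meanFreePath σ N) → ∀ z z',
      seqHistLE b c σ N Φ k q z = seqHistLE b c σ N Φ k q z' → X k q z = X k q z') →
    (∀ k q, ∀ z ∈ Φ.good, badWeight Ψ η T c σ N Φ k q z ≤ X k q z) →
    unitMean c σ N τ (localGibbsLaw σ a₀ u₀ θ₀ N Φ) (badWeight Ψ η T c σ N Φ) ≤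
      unitMean c σ N τ (localGibbsLaw σ a₀ u₀ θ₀ N Φ) X) ∧
  (∀ η' : ℝ, 0 < η' → ∀ X R : ℕ → Cell → Phase N → ℝ,
    (∀ k q z, 0 ≤ X k q z ∧ X k q z ≤ T) → (∀ k q z, 0 ≤ R k q z ∧ R k q z ≤ T) →
    (∀ k, ∀ q ∉ cellBox (c * meanFreePath σ N), X k q = fun _ => 0) →
    (∀ k, ∀ q ∉ cellBox (c * meanFreePath σ N), R k q = fun _ => 0) →
    (∀ k q, q ∈ cellBox (c * meanFreePath σ N) → ∀ z z',
      seqHistLE b c σ N Φ k q z = seqHistLE b c σ N Φ k q z' → X k q z = X k q z') →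
    (∀ k q, q ∈ cellBox (c * meanFreePath σ N) → ∀ z z',
      seqHistLE b c σ N Φ k q z = seqHistLE b c σ N Φ k q z' → R k q z = R k q z') →
    (∀ k q, ∀ z ∈ Φ.good, X k q z ≤ badWeight Ψ η' T c σ N Φ k q z + R k q z) →
    unitMean c σ N τ (localGibbsLaw σ a₀ u₀ θ₀ N Φ) (gForecast b c σ N Φ X) ≤
      unitMean c σ N τ (localGibbsLaw σ a₀ u₀ θ₀ N Φ) (gForecast b c σ N Φ (badWeight Ψ η' T c σ N Φ)) +
        unitMean c σ N τ (localGibbsLaw σ a₀ u₀ θ₀ N Φ) (gForecast b c σ N Φ R)) ∧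
  (∀ η' δ ϑs ϑ φs : ℝ, 0 < η' → 0 < δ →
    unitMean c σ N τ (localGibbsLaw σ a₀ u₀ θ₀ N Φ) (gForecast b c σ N Φ (badWeight Ψ η' T c σ N Φ)) ≤
      δ * ((c * meanFreePath σ N) ^ 3 * (cellBox (c * meanFreePath σ N)).card) +
      T * unitMean c σ N τ (localGibbsLaw σ a₀ u₀ θ₀ N Φ) (fun k q z =>
        if GoodUnit ϑs ϑ φs c σ N (Φ.flow ((k : ℝ) * stepLen c σ N) z) q ∧
            δ < gForecast b c σ N Φ (badWeight Ψ η' T c σ N Φ) k q z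
        then 1 else 0) +
      T * unitMean c σ N τ (localGibbsLaw σ a₀ u₀ θ₀ N Φ) (fun k q z =>
        if (pop c σ N (Φ.flow ((k : ℝ) * stepLen c σ N) z) q).Nonempty ∧
            ¬ GoodUnit ϑs ϑ φs c σ N (Φ.flow ((k : ℝ) * stepLen c σ N) z) q
        then 1 else 0)) ∧
  (∫⁻ z, ENNReal.ofReal (unitAvg c σ N τ fun k q => badWeight Ψ η T c σ N Φ k q z) ∂(localGibbsLaw σ a₀ u₀ θ₀ N Φ) =
    ENNReal.ofReal (unitMean c σ N τ (localGibbsLaw σ a₀ u₀ θ₀ N Φ) (badWeight Ψ η T c σ N Φ)))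

/-! ## The composition -/

/-- The kinetic scale shrinks: for `σ > 0` and every `c`, `c ℓ_N ≤ 1` for all large `N`. [folklore] -/
theorem exists_mesh_le_one {σ : ℝ} (hσ : 0 < σ) (c : ℝ) : ∃ N₀ : ℕ, ∀ N : ℕ, N₀ ≤ N → c * meanFreePath σ N ≤ 1 := by
  have ht : Tendsto (fun N : ℕ => c * meanFreePath σ N) atTop (nhds (c * 0)) :=
    (tendsto_meanFreePath hσ).const_mul c
  rw [mul_zero] at ht
  obtain ⟨N₀, hN₀⟩ := eventually_atTop.1 (ht.eventually (Iic_mem_nhds one_pos))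
  exact ⟨N₀, fun N hN => hN₀ N hN⟩

/-- **Registered helper `kineticCellChaosLG_of` (piece A of S6, the architecture of the forecast transfer): `H1 → H2 → H3 → H4 →
H5 → KineticCellChaosLG`.** Quantifiers: `σ₀ := min(σ₁ of H2, σ₀(φs) of H3, σ₀ of H4, 1/2)`; given `(σ, Φ, τ, Ψ, η, δ, T)` the
tolerances `δₘ = δ/135`, `δ₂ = δ₃ = δ/(5T)`, `δ₄ = δ/5`, `ε = δ/10`; `ϑ` and `c₀` from `H2` at `(ϑs = 1, η/2, δₘ, T, δ₂)`, `c₀`'s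
from `H3 (1, ϑ, δ₃)` and `H4 (η, δ₄, T)`; for `c ≥ max c₀`: `b := b₀(c)` of `H4`, then `N₀ := max` of the thresholds of `H1 (T, c, ε)`,
`H2`, `H3`, `H4` and of `c ℓ_N ≤ 1`; then the chain of the module docstring and `H5` (iv). [folklore] -/
theorem kineticCellChaosLG_of : ForecastSwap → BadForecastRare → NonGoodRare → RevealedSandwich → ForecastAlgebra → KineticCellChaosLG := by
  intro h1 h2 h3 h4 h5 a₀ θ₀ u₀ ha hθ hu ha0 hθ0
  obtain ⟨φs, hφs, σ₁, hσ₁, H2⟩ := h2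
  obtain ⟨σ₃, hσ₃, H3⟩ := h3 φs hφs a₀ θ₀ u₀ ha hθ hu ha0 hθ0
  obtain ⟨σ₄, hσ₄, H4⟩ := h4 a₀ θ₀ u₀ ha hθ hu ha0 hθ0
  refine ⟨min (min σ₁ σ₃) (min σ₄ (1 / 2)), by positivity, ?_⟩
  intro σ hσ hσlt Φ τ hτ Ψ hΨ hΨb η δ T hη hδ hT
  have hσ₁' : σ ≤ σ₁ := (hσlt.trans_le ((min_le_left _ _).trans (min_le_left _ _))).le
  have hσ₃' : σ < σ₃ := hσlt.trans_le ((min_le_left _ _).trans (min_le_right _ _))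
  have hσ₄' : σ < σ₄ := hσlt.trans_le ((min_le_right _ _).trans (min_le_left _ _))
  have hhalf : σ < 1 / 2 := hσlt.trans_le ((min_le_right _ _).trans (min_le_right _ _))
  -- tolerances and the thresholds of H2, H3, H4
  obtain ⟨ϑ, hϑ, c₂, hc₂, H2c⟩ := H2 a₀ θ₀ u₀ ha hθ hu ha0 hθ0 σ hσ hσ₁' hhalf.le Φ τ hτ Ψ hΨ hΨb 1 (η / 2) (δ / 135) T
    (δ / (5 * T)) one_pos (by positivity) (by positivity) hT (by positivity)
  obtain ⟨c₃, hc₃, H3c⟩ := H3 σ hσ hσ₃' Φ τ hτ 1 ϑ (δ / (5 * T)) one_pos hϑ (by positivity)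
  obtain ⟨c₄, hc₄, H4c⟩ := H4 σ hσ hσ₄' Φ τ hτ Ψ hΨ hΨb η (δ / 5) T hη (by positivity) hT
  refine ⟨max (max c₂ c₃) c₄, lt_max_of_lt_right hc₄, fun c hc => ?_⟩
  have hc₂' : c₂ ≤ c := ((le_max_left _ _).trans (le_max_left _ _)).trans hc
  have hc₃' : c₃ ≤ c := ((le_max_right _ _).trans (le_max_left _ _)).trans hc
  have hc₄' : c₄ ≤ c := (le_max_right _ _).trans hc
  have hc0 : 0 < c := hc₄.trans_le hc₄'
  -- the bin width is chosen after `c`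
  obtain ⟨b₀, hb₀, H4b⟩ := H4c c hc₄'
  obtain ⟨N₄, H4N⟩ := H4b b₀ hb₀ le_rfl
  obtain ⟨N₂, H2N⟩ := H2c c hc₂' b₀ hb₀
  obtain ⟨N₃, H3N⟩ := H3c c hc₃'
  obtain ⟨N₁, H1N⟩ := h1 a₀ θ₀ u₀ ha hθ hu ha0 hθ0 σ hσ hhalf.le Φ τ hτ T hT c hc0 (δ / 10) (by positivity)
  obtain ⟨N₆, H6⟩ := exists_mesh_le_one hσ c
  refine ⟨max (max (max N₁ N₂) (max N₃ N₄)) N₆, fun N hN => ?_⟩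
  have hN₁ : N₁ ≤ N := ((le_max_left _ _).trans ((le_max_left _ _).trans (le_max_left _ _))).trans hN
  have hN₂ : N₂ ≤ N := ((le_max_right _ _).trans ((le_max_left _ _).trans (le_max_left _ _))).trans hN
  have hN₃ : N₃ ≤ N := ((le_max_left _ _).trans ((le_max_right _ _).trans (le_max_left _ _))).trans hN
  have hN₄ : N₄ ≤ N := ((le_max_right _ _).trans ((le_max_right _ _).trans (le_max_left _ _))).trans hN
  have hN₆ : N₆ ≤ N := (le_max_right _ _).trans hN
  -- the revealed majorant and remainder
  obtain ⟨X, R, hXb, hRb, hX0, hR0, hXa, hRa, hdom, hsand, hmR⟩ := H4N N hN₄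
  obtain ⟨h5i, h5ii, h5iii, h5iv⟩ := h5 a₀ θ₀ u₀ ha hθ hu ha0 hθ0 σ hσ hhalf N (Φ N) τ hτ Ψ hΨ hΨb η T c b₀ hη hT hc0 hb₀
  -- the chain
  have e1 := h5i X hXb hX0 hXa hdom
  have e2 := H1N N hN₁ b₀ hb₀ X hXb hX0 hXa
  have e3 := h5ii (η / 2) (by positivity) X R hXb hRb hX0 hR0 hXa hRa hsand
  have e4 := H1N N hN₁ b₀ hb₀ R hRb hR0 hRa
  have e5 := h5iii (η / 2) (δ / 135) 1 ϑ φs (by positivity) (by positivity)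
  have e6 := H2N N hN₂
  have e7 := H3N N hN₃
  have e8 : (c * meanFreePath σ N) ^ 3 * ((cellBox (c * meanFreePath σ N)).card : ℝ) ≤ 27 :=
    card_cellBox_mul_le (mul_pos hc0 (meanFreePath_pos hσ N)) (H6 N hN₆)
  rw [h5iv]
  refine ENNReal.ofReal_le_ofReal ?_
  rw [abs_le] at e2 e4
  have e9 : δ / 135 * ((c * meanFreePath σ N) ^ 3 * ((cellBox (c * meanFreePath σ N)).card : ℝ)) ≤ δ / 135 * 27 :=
    mul_le_mul_of_nonneg_left e8 (by positivity)
  have e10 := mul_le_mul_of_nonneg_left e6 hT.le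
  have e11 := mul_le_mul_of_nonneg_left e7 hT.le
  have e12 : T * (δ / (5 * T)) = δ / 5 := by field_simp
  linarith

end Summit.AtomisticToContinuum.HydrodynamicLimit.Theorems.EquilibriumForecastLine

end
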